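import Summits.ResolutionOfSingularities.ResolutionOfSingularities.Theses.VerticalModels
import Literature.AlgebraicGeometry.Resolution.Blowups
import HarnessLib

/-!
# Crux `TameArcRegularization` (stmt-ResolutionOfSingularities-16198) — birth skeleton (BC3), line `birth`

Route `ResolutionOfSingularities/VerticalModels`, crux #3 (rank 3, difficulty L):
`TameArcRegularization` = "for vertical data `(p, k, X, f : X → 𝔸¹_k, q)` (q irreducible, `X`
integral, separated of finite type, regular wherever `t := f^* q` is a unit, and `t` a unit
somewhere) there is a blow-up `π : X' → X` along an ideal sheaf co-supported in the fibre `V(t)`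
such that `X'` is regular at every point reached by a TAME arc — an arc `a : Spec k'⟦s⟧ → X'`
centred there with `ord_s (a^* π^* f^* q) = m`, `p ∤ m`".

## The cut (two named stubs; `TameArcRegularization_of` proved)

This is the planner's own foreseen two-layer split of the crux (route header, TWO-LAYER PLAN:
"TameArcRegularization ⇐ NeronBlowupSmoothening → TameCyclicDescent → TameArcRegularization"),
typed so that the first piece is CONSUMABLE by the second:

* `stub_equivariantUnramifiedRegularization` — **Néron smoothening in blow-up form, for
  UNRAMIFIED arcs (`ord = 1`), all residue fields, equivariant** (`EquivariantUnramifiedRegularization`):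
  for every vertical datum there is a fibre-co-supported blow-up `π : X' → X` such that
  (i) `X'` is regular at every point reached by an arc along which the pulled-back `q` is a
  UNIFORMIZER (`ord_s = 1`: the `m = 1` slice of the crux's conclusion — these are exactly the
  `R'`-valued points of `X` for the discrete valuation rings `R' = k'⟦s⟧` dominating
  `R = k[T]_{(q)}` with ramification index 1), and (ii) every automorphism `σ` of `X` covering a
  ring automorphism `φ` of `k[T]` with `φ(q) ~ q` lifts to an automorphism of `X'` over `σ`
  (canonicity of the procedure: Néron's centres are the schematic closures of the loci of
  maximal defect `δ`, intrinsic to the pair `(X → Spec R, (q))`). Engine in tree, PROVED in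
  affine-chart form: `Literature.AlgebraicGeometry.Smoothening.Forest.nonempty_smoothening`
  (BLR 1990 §3.3–3.4: finitely many dilatation charts after which every test point has Néron
  defect 0, hence is smooth, hence regular), defect machinery `NeronModels/NeronDefect.lean`,
  dilatations `NeronModels/Dilatation*.lean`. Gaps this stub carries (the crux's why-might-fail,
  first half): BLR control `R^{sh}`-points, i.e. SEPARABLE residue extensions of `k(c) = k[T]/(q)`,
  while clause (i) allows any residue field `k'` (inseparable over the imperfect `k(c)`), where
  smoothness fails and only regularity can be hoped for; charts ↦ ONE global blow-up along a
  fibre-co-supported ideal sheaf (dilatation = affine blow-up, `DilatationInBlowup.lean`;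
  composition `BlowupsComposition.lean`); the lifting clause (ii) for the composite.
  Size: L. [cite: BoschLutkebohmertRaynaud1990 §3.1 Thm 3, §3.3 Prop 5/6, §3.4 Thm 2;
  Neron1964; arXiv:2001.03597 §2–3]
* `stub_tameCyclicDescent` — **tame cyclic descent** (`EquivariantUnramifiedRegularization →
  TameArcRegularization`): for a vertical datum and a tame level `E` (`p ∤ E`), base-change along
  `k[T] → B_E := k[T][s]/(s^E − q)` (finite flat; étale where `q` is a unit, so regularity off
  the fibre ascends), normalise (finite: excellent), and apply the first stub to each integral
  component `Y_i → 𝔸¹_s` with parameter `s` (again a vertical datum: `Y_i` dominates `X` by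
  flatness, so `s` is a unit somewhere; regular off `V(s)`): every arc of `X` with `ord q = e`,
  `e ∣ E`, lifts after the reparametrisation `s ↦ s^{E/e}` (and adjoining `u^{1/e}`, separable as
  `p ∤ e`) to an arc of some `Y_i` with `ord s = 1`, i.e. lands in the locus clause (i) makes
  regular; the group `μ_E ⋊ Gal(k(ζ_E)/k)` acts on `⊔ Y_i` through ring automorphisms of
  `k(ζ_E)[s]` fixing `(s)` — exactly the automorphisms clause (ii) lifts (lifts are unique
  because blow-ups of integral schemes along non-zero ideals are birational onto a separated
  scheme, so they assemble to an action) — and the quotient of the blown-up cover by `μ_E`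
  (linearly reductive: invariants of the Rees algebra) is finite-birational over `X` and an
  isomorphism off the fibre; its points under tame-order-`e ∣ E` arcs are TAME QUOTIENT
  singularities of regular points, resolved functorially (hence equivariantly and compatibly
  with further descent) by destackification (BerghRydh2019) / toroidal methods; realising
  normalisation + quotient + that resolution as ONE blow-up of `X` along a fibre-co-supported
  ideal sheaf (finite birational modifications that are isomorphisms off `V(q)`, composed with
  blow-ups: `BlowupsComposition.lean`, Liu 2002 Thm. 8.1.24 in the quasi-projective case) and
  closing the ideal up over the wild locus are part of this stub. What this
  stub ALSO carries (the crux's why-might-fail, second half): the passage from "regular at points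
  reached by arcs of order dividing `E`" for each `E` to "regular at ALL tame-reachable points"
  for ONE blow-up — a bound on the minimal tame arc orders at the points of the model actually
  constructed (constructibility of arc conditions à la Greenberg / Denef–Loeser on the fixed `X`
  is available; UNIFORMITY over arbitrary fibre-co-supported blow-ups is FALSE — blow up
  `(x, y^M)` on `𝔸² → 𝔸¹_x` (regular, nothing to resolve): the point `u = y = 0` of the chart
  `x = u y^M` is reached by the arc `(u, y) = (s, s)` of order `M + 1` and by none of smaller
  order — so the bound must come from the specific Néron/quotient construction, which is why it
  cannot be split off as a black-box third stub `(∀ E, regular at orders ∣ E) → crux`: such a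
  stub could only be proved by reproving the crux). Size: L (open-ended at the last point).
  [cite: BerghRydh2019; GrothendieckMurre1971 (tame covers); arXiv:1905.00872;
  BoschLutkebohmertRaynaud1990 §3.6 (base change and descent of smoothenings)]
* The assembly `TameArcRegularization_of : Sig.stub_equivariantUnramifiedRegularization →
  Sig.stub_tameCyclicDescent → TameArcRegularization` is PROVED (modus ponens — a deliberately
  trivial seam: all mathematics sits in the two named stubs, none in an unnamed step), and
  `TameArcRegularization_proof : TameArcRegularization` plugs the two `stub_*` in.
* Sanity (PROVED, no sorry): `UnramifiedArcRegularization` (clause (i) alone) is implied both by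
  the first stub's statement (`EquivariantUnramifiedRegularization.unramified`, projection) and
  by the crux itself (`unramified_of_tameArcRegularization`, the slice `m = 1`, `p ∤ 1`) — so
  stub 1 is the unramified SPECIAL CASE of the crux made canonical, and stub 2 is the genuine
  reduction of all tame orders to order 1; neither is the crux or the summit reworded (BC3
  probes in the planner's folder `bc/TameArcRegularization_bc3_probes*.lean`: all FAIL).

Disproof used: none on file for this crux (`ledger crux ls stmt-ResolutionOfSingularities-16198`:
no `Disproof.lean`, no `Negative/` lemmas; `ledger negatives --problem ResolutionOfSingularities`
lists one unrelated refuted statement (DefectlessFrames, valuation-theoretic) on 2026-08-17).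
Refuter note on file (evidence `WildCoreIsTarget.md`, 2026-08-16): the crux is a consequence of
the target `VerticalResolution` and is not load-bearing for `closes` as the route is presently
glued — a ROUTE-shape finding for the tenure/repair planner, not a defect of this skeleton, whose
stubs are probed against the crux and the summit below.
-/

noncomputable section

-- single-problem summit: the doubled namespace component `ResolutionOfSingularities` is forced
set_option linter.dupNamespace false

open CategoryTheory AlgebraicGeometry Literature.AlgebraicGeometry.Resolution
open Summit.ResolutionOfSingularities.ResolutionOfSingularities.Theses.VerticalModels (TameArcRegularization)

namespace Summit.ResolutionOfSingularities.ResolutionOfSingularities.Cruxes.TameArcRegularization.Lines.Birth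

/-! ## The predicates of the cut

All three are stated over exactly the crux's vertical data `(p, k, X, f, q)` and hypotheses,
copied verbatim from `Theses/VerticalModels.lean` (`TameArcRegularization`), so that no coercion
or re-bundling stands between the stubs and the crux. -/

/-- **Unramified-arc regularization** (the slice `m = 1` of the crux's conclusion): for every
vertical datum there is a blow-up `π : X' → X` along an ideal sheaf co-supported in the fibre
`V(f^* q)` such that `X'` is regular at every point `x'` centred under an arc
`a : Spec k'⟦s⟧ → X'` along which the pulled-back `q` has `s`-order exactly `1` (a uniformizer:
`a` is an unramified `k'⟦s⟧`-point of the model `X'` over `k[T]_{(q)}`, residue field `k'`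
arbitrary). Néron smoothening in blow-up form. [cite: BoschLutkebohmertRaynaud1990, §3.1 Thm. 3,
§3.4 Thm. 2; Neron1964] -/
def UnramifiedArcRegularization : Prop :=
  ∀ p : ℕ, p.Prime → ∀ (k : Type) [Field k] [CharP k p] (X : AlgebraicGeometry.Scheme.{0})
    (f : X ⟶ AlgebraicGeometry.Spec (.of (Polynomial k))) (q : Polynomial k), Irreducible q →
    AlgebraicGeometry.IsIntegral X → AlgebraicGeometry.IsSeparated f →
    AlgebraicGeometry.LocallyOfFiniteType f → AlgebraicGeometry.QuasiCompact f →
    (∃ x : X, IsUnit (X.presheaf.germ ⊤ x trivial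
      (f.appTop ((AlgebraicGeometry.Scheme.ΓSpecIso (.of (Polynomial k))).inv q)))) →
    (∀ x : X, IsUnit (X.presheaf.germ ⊤ x trivial
      (f.appTop ((AlgebraicGeometry.Scheme.ΓSpecIso (.of (Polynomial k))).inv q))) →
      IsRegularLocalRing (X.presheaf.stalk x)) →
    ∃ (I : X.IdealSheafData) (X' : AlgebraicGeometry.Scheme.{0}) (π : X' ⟶ X),
      Literature.AlgebraicGeometry.Resolution.IsBlowup π I ∧
      (I.support : Set X) ⊆ {x | ¬ IsUnit (X.presheaf.germ ⊤ x trivial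
        (f.appTop ((AlgebraicGeometry.Scheme.ΓSpecIso (.of (Polynomial k))).inv q)))} ∧
      ∀ x' : X', (∃ (k' : Type) (_ : Field k') (a : AlgebraicGeometry.Spec (.of (PowerSeries k')) ⟶ X'),
          a.base (IsLocalRing.closedPoint (PowerSeries k')) = x' ∧
          ((AlgebraicGeometry.Scheme.ΓSpecIso (.of (PowerSeries k'))).hom
            ((CategoryTheory.CategoryStruct.comp a (CategoryTheory.CategoryStruct.comp π f)).appTop
              ((AlgebraicGeometry.Scheme.ΓSpecIso (.of (Polynomial k))).inv q))).order = 1) →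
        IsRegularLocalRing (X'.presheaf.stalk x')

/-- **Equivariant unramified-arc regularization** — `UnramifiedArcRegularization` with the
blow-up CANONICAL in the only sense the descent needs: every automorphism `σ : X ≅ X` covering a
ring automorphism `φ` of `k[T]` that fixes the ideal `(q)` (`φ q ~ q`; e.g. `s ↦ ζ s` composed
with a Galois automorphism of the constants) lifts to an automorphism `σ'` of `X'` with
`σ' ≫ π = π ≫ σ`. For Néron's procedure the centres are schematic closures of maximal-defect
loci, intrinsic to `(X → Spec k[T]_{(q)}, (q))`, so each step — hence the composite — admits the
lift by the universal property of blowing up. [cite: BoschLutkebohmertRaynaud1990, §3.4 Thm. 2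
and §3.6; arXiv:2001.03597, §2–3] -/
def EquivariantUnramifiedRegularization : Prop :=
  ∀ p : ℕ, p.Prime → ∀ (k : Type) [Field k] [CharP k p] (X : AlgebraicGeometry.Scheme.{0})
    (f : X ⟶ AlgebraicGeometry.Spec (.of (Polynomial k))) (q : Polynomial k), Irreducible q →
    AlgebraicGeometry.IsIntegral X → AlgebraicGeometry.IsSeparated f →
    AlgebraicGeometry.LocallyOfFiniteType f → AlgebraicGeometry.QuasiCompact f →
    (∃ x : X, IsUnit (X.presheaf.germ ⊤ x trivial
      (f.appTop ((AlgebraicGeometry.Scheme.ΓSpecIso (.of (Polynomial k))).inv q)))) →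
    (∀ x : X, IsUnit (X.presheaf.germ ⊤ x trivial
      (f.appTop ((AlgebraicGeometry.Scheme.ΓSpecIso (.of (Polynomial k))).inv q))) →
      IsRegularLocalRing (X.presheaf.stalk x)) →
    ∃ (I : X.IdealSheafData) (X' : AlgebraicGeometry.Scheme.{0}) (π : X' ⟶ X),
      Literature.AlgebraicGeometry.Resolution.IsBlowup π I ∧
      (I.support : Set X) ⊆ {x | ¬ IsUnit (X.presheaf.germ ⊤ x trivial
        (f.appTop ((AlgebraicGeometry.Scheme.ΓSpecIso (.of (Polynomial k))).inv q)))} ∧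
      (∀ x' : X', (∃ (k' : Type) (_ : Field k') (a : AlgebraicGeometry.Spec (.of (PowerSeries k')) ⟶ X'),
          a.base (IsLocalRing.closedPoint (PowerSeries k')) = x' ∧
          ((AlgebraicGeometry.Scheme.ΓSpecIso (.of (PowerSeries k'))).hom
            ((CategoryTheory.CategoryStruct.comp a (CategoryTheory.CategoryStruct.comp π f)).appTop
              ((AlgebraicGeometry.Scheme.ΓSpecIso (.of (Polynomial k))).inv q))).order = 1) →
        IsRegularLocalRing (X'.presheaf.stalk x')) ∧
      ∀ (φ : Polynomial k ≃+* Polynomial k) (σ : X ≅ X), Associated (φ q) q →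
        σ.hom ≫ f = f ≫ AlgebraicGeometry.Spec.map (CommRingCat.ofHom φ.toRingHom) →
        ∃ σ' : X' ≅ X', σ'.hom ≫ π = π ≫ σ.hom

/-! ## Sanity (proved): where the first predicate sits -/

/-- The equivariant statement contains the plain unramified one (drop the lifting clause).
[folklore] -/
theorem EquivariantUnramifiedRegularization.unramified (h : EquivariantUnramifiedRegularization) :
    UnramifiedArcRegularization := by
  intro p hp k _ _ X f q hq hint hsep hlft hqc hunit hreg
  obtain ⟨I, X', π, hb, hs, hreg', _⟩ := h p hp k X f q hq hint hsep hlft hqc hunit hreg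
  exact ⟨I, X', π, hb, hs, hreg'⟩

/-- The crux contains the plain unramified statement: an arc along which `q` is a uniformizer
is a tame arc of order `m = 1` (`p ∤ 1` for a prime `p`). So stub 1 is the unramified special
case of the crux (made canonical), and stub 2 the reduction of every tame order to it. [folklore] -/
theorem unramified_of_tameArcRegularization (h : TameArcRegularization) :
    UnramifiedArcRegularization := by
  intro p hp k _ _ X f q hq hint hsep hlft hqc hunit hreg
  obtain ⟨I, X', π, hb, hs, hreg'⟩ := h p hp k X f q hq hint hsep hlft hqc hunit hreg
  refine ⟨I, X', π, hb, hs, fun x' hx' => hreg' x' ?_⟩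
  obtain ⟨k', iK, a, ha, hord⟩ := hx'
  refine ⟨k', iK, a, 1, ha, ?_, ?_⟩
  · simpa using hord
  · exact hp.not_dvd_one

/-! ## The two stub STATEMENTS by name (`Sig.stub_<name>`, the registered-signature convention of
birth skeletons: the composition `TameArcRegularization_of` takes exactly these as hypotheses) -/

/-- Statement of `stub_equivariantUnramifiedRegularization`: Néron smoothening in blow-up form,
unramified arcs, all residue fields, with lifting of fibre-preserving automorphisms.
[cite: BoschLutkebohmertRaynaud1990, §3.4 Thm. 2] -/
def Sig.stub_equivariantUnramifiedRegularization : Prop :=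
  EquivariantUnramifiedRegularization

/-- Statement of `stub_tameCyclicDescent`: equivariant unramified regularization of the
normalised tame cyclic base changes `s^E = q` descends through the `μ_E`-quotient and tame
destackification to regularity at all tame-reachable points of one fibre-co-supported blow-up.
[cite: BerghRydh2019; GrothendieckMurre1971] -/
def Sig.stub_tameCyclicDescent : Prop :=
  EquivariantUnramifiedRegularization → TameArcRegularization

/-! ## The stubs -/

/-- **STUB 1 (size L; engine proved in tree in chart form).** Equivariant Néron smoothening in
blow-up form: see the module docstring (`Smoothening/Forest.lean: nonempty_smoothening`,
`NeronDefect.lean`, `Dilatation*.lean`; gaps: inseparable residue fields, one global blow-up,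
lifting of automorphisms). [cite: BoschLutkebohmertRaynaud1990, §3.1 Thm. 3, §3.3, §3.4 Thm. 2;
Neron1964; arXiv:2001.03597, §2–3] -/
theorem stub_equivariantUnramifiedRegularization : EquivariantUnramifiedRegularization := by
  sorry

/-- **STUB 2 (size L, load-bearing).** Tame cyclic descent: base change `s^E = q` (`p ∤ E`),
normalisation, stub 1 on the components over `𝔸¹_s`, `μ_E ⋊ Gal`-action by the lifting clause,
quotient, functorial tame destackification, closing the ideal over the wild locus, and the bound
on minimal tame orders for the model so constructed (module docstring). [cite: BerghRydh2019;
GrothendieckMurre1971; arXiv:1905.00872; BoschLutkebohmertRaynaud1990, §3.6] -/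
theorem stub_tameCyclicDescent (h : EquivariantUnramifiedRegularization) :
    TameArcRegularization := by
  sorry

/-! ## The composition (kernel-checked; no `sorry` in its own term) -/

/-- **`TameArcRegularization` from the two stub statements** — the assembly, PROVED: the descent
stub consumes the equivariant unramified regularization and concludes the crux BY NAME
(`Summit.ResolutionOfSingularities.ResolutionOfSingularities.Theses.VerticalModels.TameArcRegularization`).
[folklore] -/
theorem TameArcRegularization_of :
    Sig.stub_equivariantUnramifiedRegularization → Sig.stub_tameCyclicDescent →
      TameArcRegularization :=
  fun h₁ h₂ => h₂ h₁

/-- **The crux `TameArcRegularization`, assembled from the two registered stubs** (the skeleton in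
its final shape: `TameArcRegularization_of` with the `stub_*` plugged in; the only `sorry`s in its
closure are the two stubs, none of its own). -/
theorem TameArcRegularization_proof : TameArcRegularization :=
  TameArcRegularization_of stub_equivariantUnramifiedRegularization stub_tameCyclicDescent

end Summit.ResolutionOfSingularities.ResolutionOfSingularities.Cruxes.TameArcRegularization.Lines.Birth

end
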